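import Literature.AlgebraicGeometry.HodgeTheory.LefschetzOneOneOfGAGA
import Literature.AlgebraicGeometry.HodgeTheory.GAGALineBundlesHolds
import Literature.AlgebraicGeometry.HodgeTheory.HodgeFiltrationModelsReductionProofs
import HarnessLib

/-!
# A rational `(1,1)`-class is a complex multiple of `c₁(𝒪_X(D)^an)` for one Cartier divisor `D`

Family `hodge`, layer `Literature/AlgebraicGeometry/HodgeTheory` (toward the sub-stub G4 of the named fact
`topHodgeClasses_spanned_by_pullbacks`, crux stmt-HodgeConjecture-2782, line `regime-split-middle-step`).
The tree proves the Lefschetz theorem on `(1,1)`-classes in first-Chern-class form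
(`exists_eq_smul_chernCharacter_lineBundle`: a rational `(1,1)`-class is `a • ch₁(L)` for ONE holomorphic line
cocycle `L` on a Hodge model; Voisin I Thm. 11.30) and GAGA for line bundles
(`serreGAGA_lineCocycle_iso_cartierDivisorCocycle_holds`: `L ≅ 𝒪_X(D)^an` holomorphically; Serre, GAGA n° 20).
This file draws the consequence on the summit carriers, for ANY given Hodge model `A` (independence of the
Hodge type from the model, `hodgePQ_independent_of_hodgeModel_holds`):

* `exists_eq_smul_chernCharacter_cartierDivisorCocycle` — **every rational class of Hodge type `(1,1)` in
  `H²(X(ℂ); ℂ)` is `a • ch₁(𝒪_X(D)^an)` for some Cartier divisor `D` on `X` and `a : ℂ`** (isomorphism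
  invariance of the Chern character, `CocycleIso.chernCharacterDeRham_eq`).

Everything is proved; no definitions, no named facts. What remains for the embedding-currency form of
Lefschetz `(1,1)` (every such class is a combination of `ch₁(𝒪(-1)|_X)` over closed immersions
`X ⟶ ℙᴷ`) is divisor bookkeeping: `D ∼ G₁^*H − G₂^*H` (Serre's theorem A).

## References

* [VoisinHodgeI2002] C. Voisin, Hodge Theory and Complex Algebraic Geometry I, CUP 2002, Thm. 11.30, Thm. 11.33.
* [SerreGAGA1956] J.-P. Serre, Géométrie algébrique et géométrie analytique, n° 20 Prop. 18.
* [Kobayashi1987] S. Kobayashi, Differential Geometry of Complex Vector Bundles, Ch. II §2 (2.10).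
-/

noncomputable section

open scoped Manifold ContDiff
open CategoryTheory AlgebraicGeometry
open Literature.AlgebraicGeometry Literature.Geometry.Kaehler Literature.AlgebraicTopology.SingularHomology

namespace Literature.AlgebraicGeometry.HodgeTheory

section HodgeTheory

variable {n : ℕ} {X : Motives.SchemeOver ℂ}

/-- **A rational `(1,1)`-class is `a • c₁(𝒪_X(D)^an)` for one Cartier divisor `D`**, on any Hodge model
`A` of the smooth projective `X`: Lefschetz `(1,1)` in first-Chern-class form
(`exists_eq_smul_chernCharacter_lineBundle`), GAGA for the line cocycle
(`serreGAGA_lineCocycle_iso_cartierDivisorCocycle_holds`) and isomorphism invariance of `ch₁`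
(`CocycleIso.chernCharacterDeRham_eq`). [cite: VoisinHodgeI2002, Thm. 11.30 and Thm. 11.33]
[cite: SerreGAGA1956, n° 20 Prop. 18] -/
theorem exists_eq_smul_chernCharacter_cartierDivisorCocycle [IsIntegral X.left]
    (hX : Motives.IsSmoothProjective n X) (A : HodgeModel n X) (y : complexBetti X (2 * 1))
    (hy : IsRationalClass y) (h11 : IsOfHodgeType n X (2 * 1) 1 1 y) :
    ∃ (D : Motives.CartierDivisor X.left) (a : ℂ),
      y = a • A.chernCharacter (cartierDivisorCocycle A.isAnalytification D) 1 := by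
  obtain ⟨A', hA'⟩ := h11
  have hA : A.pullback (2 * 1) y ∈ A.hodgePQ (2 * 1) 1 1 :=
    hodgePQ_independent_of_hodgeModel_holds n X hX A' A (2 * 1) 1 1 y hA'
  obtain ⟨ι, L, a, rfl⟩ := exists_eq_smul_chernCharacter_lineBundle hX A y hy hA
  obtain ⟨D, Φ, hΦ⟩ := serreGAGA_lineCocycle_iso_cartierDivisorCocycle_holds hX A ι L.toSmoothCocycle
    L.toSmoothCocycle_isHolomorphic
  refine ⟨D, a, ?_⟩
  congr 1
  exact A.pullback_injective (2 * 1) (by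
    rw [A.pullback_chernCharacter_eq, A.pullback_chernCharacter_eq,
      SmoothComplexVectorBundle.CocycleIso.chernCharacterDeRham_eq
        (SmoothComplexVectorBundle.mk_eq_mk_of_isChernCharacterForm_holds A.model A.carrier) Φ hΦ.isSmooth 1])

end HodgeTheory

end Literature.AlgebraicGeometry.HodgeTheory

end
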